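import Summits.BirchSwinnertonDyer.BirchSwinnertonDyer.Theorems.ByReductionTypeAtTwoRankOneAtTwoBigImageOddLocalOneDoorHalvesKLossless
import Summits.BirchSwinnertonDyer.BirchSwinnertonDyer.Theorems.ByReductionTypeAtTwoRankOneAtTwoBigImageOddLocalOneDoorHalvesNamed
import HarnessLib

/-!
# Route ByReductionTypeAtTwo, crux `RankOneAtTwoBigImageOddLocal` (stmt-BirchSwinnertonDyer-23715), LINE v8.6 `one_door_analytic`:
# the NAMED halves from the K-side — `DoorIndexLawUpperCAtTwo` from Kolyvagin's UPPER bound at `2` over `K`, and the iffs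

Width prover seat `bsd-line-fkl-p2` g8 (2026-08-28), `--supports stmt-BirchSwinnertonDyer-23715`; answer to the LEAD's 11:09:46Z ask
(«Kolyvagin UPPER bound at 2 over K, c-corrected ⟹ U on the slice; conclude U = `RankOneAtTwoOneDoor.DoorIndexLawUpperCAtTwo` BY NAME so
the skeleton's `stub_doorUpperC` inherits it»).  THEOREMS ONLY; conditional by design; BSD is not proved by any of this.

Composition of two landed layers: the LEAD's `…OneDoorHalvesNamed.lean` (p628851: AN-28c-U ⟺ the Euler-system half of `BSD₂` on the whole
slice, AN-28c-L ⟺ the main-conjecture half, modulo the four primary facts and `S_rankZeroTwin`) and the width seat's K-side files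
`…OneDoorHalvesKSlice.lean` / `…OneDoorHalvesKLossless.lean` (p627493 / p628281: the halves of `BSD₂` on the slice ⟺ the one-sided K-side
binders hXU / hXL on the Kolyvagin-admissible Hoffstein–Luo doors, modulo Gross–Zagier, GZK, modularity, Hoffstein–Luo, Milne 1972 and
`S_rankZeroTwin`).

* `doorIndexLawUpperCAtTwo_of_shaUpperCAtTwo` — **AN-28c-U BY NAME from hXU** = Kolyvagin's UPPER BOUND at `2` over `K`, c-corrected, at
  conductor `1`: for `W` on the slice, `K` with odd `d_K ≠ −3`, Heegner, `d_K·(−|Δ|)`, `d_K·(−2|Δ|)` non-squares, EVERY datum `Dt`, `β`,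
  `ι`, conductor-`1` datum with `y_K` of infinite order and exact exponent `M₀`: `ord₂ #Ш(E_K)[2^∞] + 2·v₂(c) ≤ 2·M₀`.
* `doorIndexLawLowerCAtTwo_of_shaLowerCAtTwo` — AN-28c-L BY NAME from hXL (`2·M₀ ≤ ord₂ #Ш(E_K)[2^∞] + 2·v₂(c)`).
* **`doorIndexLawUpperCAtTwo_iff_shaUpperCAtTwo`** / **`doorIndexLawLowerCAtTwo_iff_shaLowerCAtTwo`** — U ⟺ hXU′, L ⟺ hXL′ (the binders
  carrying the slice's odd-torsion hypothesis), modulo PRINT and `S_rankZeroTwin`.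
* `…_of_rankZero_cruxes` — the same with the route's four rank-`0` cruxes BY NAME in place of `S_rankZeroTwin`.

Net for the planners: `stub_doorUpperC` of 23715 (E-side, Heegner-index currency) and the c-corrected conductor-`1` form of route
GenusKolyvaginAtTwo's K-side UPPER stub of `KolyvaginExactAtTwo` (stmt-22137) are the SAME statement modulo PRINT + rank-`0` `BSD₂`
(kernel iff); one Kolyvagin-system upper bound at `2` under full `2`-adic image serves both routes' Euler-system halves, and alone retires
the fkl residue (5b).  Neither half is in print at `p = 2`.  Nothing here is asserted.

References: [GrossLMS1991] Thm. 1.3, §2 Conj. (2.2), §4; [KolyvaginEulerSystems1990] Thm. A; [Milne1972ArithmeticAV] §1 Thm. 1;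
[Miller2011LMS] Def. 1.1.
-/

set_option autoImplicit false
-- the Theorems namespace of this sub repeats the summit name by design (D-0017 nested layout)
set_option linter.dupNamespace false

noncomputable section

open scoped Classical

namespace Summit.BirchSwinnertonDyer.BirchSwinnertonDyer.Theorems.RankOneAtTwoOneDoor

open WeierstrassCurve NumberField Literature.NumberTheory.EllipticCurves Literature.NumberTheory.EllipticCurves.ModularForms
  Literature.NumberTheory.EllipticCurves.Rank1Residual
  Literature.NumberTheory.EllipticCurves.Rank1Residual.Typed
  Literature.NumberTheory.EllipticCurves.KrizLi2019
  Summit.BirchSwinnertonDyer.Rank1Residual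
  Summit.BirchSwinnertonDyer.Rank1Residual.AdditivePotMult
  Summit.BirchSwinnertonDyer.Rank1Residual.F1Sign2
  Summit.BirchSwinnertonDyer.Rank1Residual.F1Sign2.TranspositionDoor
  Summit.BirchSwinnertonDyer.BirchSwinnertonDyer.Theses.ByReductionTypeAtTwo
  Summit.BirchSwinnertonDyer.BirchSwinnertonDyer.Theorems.CMExactDescent

/-! ### §1 The named halves from the one-sided K-side binders -/

/-- **AN-28c-U `DoorIndexLawUpperCAtTwo` BY NAME FROM KOLYVAGIN'S UPPER BOUND AT `2` OVER `K`** (binder `hXU`: c-corrected, conductor `1`,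
on the Kolyvagin-admissible Hoffstein–Luo doors of slice curves), PRINT (`gross_zagier`, `kolyvagin`, GZK, `exists_isNewformOf`,
Hoffstein–Luo, Milne 1972) and `S_rankZeroTwin`: the Euler-system half of `BSD₂` holds on the slice
(`missingUpperBoundAt_two_onSlice_of_shaUpperCAtTwo`), hence U (`doorIndexLawUpperCAtTwo_of_missingUpperBoundAt_onSlice`, lead g8).  The
theorem the skeleton's `stub_doorUpperC` inherits.  Conditional by design; BSD is not proved by this.
[cite: GrossLMS1991, Thm. 1.3 and §4] [cite: KolyvaginEulerSystems1990, Thm. A] [cite: Milne1972ArithmeticAV, §1 Thm. 1] -/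
theorem doorIndexLawUpperCAtTwo_of_shaUpperCAtTwo
    (hGZ : ∀ (N : ℕ) [NeZero N] (W : WeierstrassCurve ℚ) (K : Type) [Field K] [NumberField K], gross_zagier N W K)
    (hKo : ∀ (N : ℕ) [NeZero N] (W : WeierstrassCurve ℚ) (K : Type) [Field K] [NumberField K], kolyvagin N W K)
    (hGZK : rank_eq_analyticRank_of_analyticRank_le_one) (hnf : exists_isNewformOf)
    (hHL : HoffsteinLuo1997_exists_twist_L_one_ne_zero) (hMilneC : Milne1972.bsdQuotient_baseChange_quadratic_anyModel)
    (hXU : ∀ (W : WeierstrassCurve ℚ) [W.IsElliptic] [W.IsGloballyMinimal] [NeZero (W.conductorNorm ℤ)],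
      ¬ W.HasCM → (∀ n : ℕ, W.HasSurjectiveModNGaloisRep ((2 ^ n : ℕ) : ℤ)) → Odd W.tamagawaProduct → W.analyticRank = 1 →
      ∀ (K : Type) [Field K] [NumberField K], IsImaginaryQuadratic K → Odd (NumberField.discr K) →
        NumberField.discr K ≠ -3 → SatisfiesHeegnerHypothesis (W.conductorNorm ℤ) K →
        ¬ IsSquare ((NumberField.discr K : ℚ) * -|W.Δ|) → ¬ IsSquare ((NumberField.discr K : ℚ) * (-(2 * |W.Δ|))) →
        ∀ (Dt : ModularParametrizationData W (W.conductorNorm ℤ)) (β : ℤ) (ι : K →+* ℂ) (d₁ : KolyvaginHeegnerData Dt β ι 1),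
          ¬ IsOfFinAddOrder d₁.derivedPoint → ∀ (M₀ : ℕ),
          (∃ Q : (W.baseChange (ringClassField K ι 1)).toAffine.Point, ((2 ^ M₀ : ℕ) : ℤ) • Q = d₁.derivedPoint) →
          (¬ ∃ Q : (W.baseChange (ringClassField K ι 1)).toAffine.Point, ((2 ^ (M₀ + 1) : ℕ) : ℤ) • Q = d₁.derivedPoint) →
          (padicValNat 2 (Nat.card (AddCommGroup.primaryComponent (W.baseChange K).sha 2)) : ℤ) + 2 * padicValInt 2 Dt.c ≤ 2 * M₀)
    (hZ : S_rankZeroTwin) : DoorIndexLawUpperCAtTwo :=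
  doorIndexLawUpperCAtTwo_of_missingUpperBoundAt_onSlice hGZ hKo hnf hHL
    (missingUpperBoundAt_two_onSlice_of_shaUpperCAtTwo hGZ hGZK hnf hHL hMilneC hXU hZ) hZ

/-- **AN-28c-L `DoorIndexLawLowerCAtTwo` BY NAME from the reverse K-inequality** (binder `hXL`), PRINT and `S_rankZeroTwin`.
Conditional by design. [cite: GrossLMS1991, §2 Conj. (2.2) and §4] [cite: Milne1972ArithmeticAV, §1 Thm. 1] -/
theorem doorIndexLawLowerCAtTwo_of_shaLowerCAtTwo
    (hGZ : ∀ (N : ℕ) [NeZero N] (W : WeierstrassCurve ℚ) (K : Type) [Field K] [NumberField K], gross_zagier N W K)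
    (hKo : ∀ (N : ℕ) [NeZero N] (W : WeierstrassCurve ℚ) (K : Type) [Field K] [NumberField K], kolyvagin N W K)
    (hGZK : rank_eq_analyticRank_of_analyticRank_le_one) (hnf : exists_isNewformOf)
    (hHL : HoffsteinLuo1997_exists_twist_L_one_ne_zero) (hMilneC : Milne1972.bsdQuotient_baseChange_quadratic_anyModel)
    (hXL : ∀ (W : WeierstrassCurve ℚ) [W.IsElliptic] [W.IsGloballyMinimal] [NeZero (W.conductorNorm ℤ)],
      ¬ W.HasCM → (∀ n : ℕ, W.HasSurjectiveModNGaloisRep ((2 ^ n : ℕ) : ℤ)) → Odd W.tamagawaProduct → W.analyticRank = 1 →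
      ∀ (K : Type) [Field K] [NumberField K], IsImaginaryQuadratic K → Odd (NumberField.discr K) →
        NumberField.discr K ≠ -3 → SatisfiesHeegnerHypothesis (W.conductorNorm ℤ) K →
        ¬ IsSquare ((NumberField.discr K : ℚ) * -|W.Δ|) → ¬ IsSquare ((NumberField.discr K : ℚ) * (-(2 * |W.Δ|))) →
        ∀ (Dt : ModularParametrizationData W (W.conductorNorm ℤ)) (β : ℤ) (ι : K →+* ℂ) (d₁ : KolyvaginHeegnerData Dt β ι 1),
          ¬ IsOfFinAddOrder d₁.derivedPoint → ∀ (M₀ : ℕ),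
          (∃ Q : (W.baseChange (ringClassField K ι 1)).toAffine.Point, ((2 ^ M₀ : ℕ) : ℤ) • Q = d₁.derivedPoint) →
          (¬ ∃ Q : (W.baseChange (ringClassField K ι 1)).toAffine.Point, ((2 ^ (M₀ + 1) : ℕ) : ℤ) • Q = d₁.derivedPoint) →
          2 * (M₀ : ℤ) ≤ (padicValNat 2 (Nat.card (AddCommGroup.primaryComponent (W.baseChange K).sha 2)) : ℤ) + 2 * padicValInt 2 Dt.c)
    (hZ : S_rankZeroTwin) : DoorIndexLawLowerCAtTwo :=
  doorIndexLawLowerCAtTwo_of_missingLowerBoundAt_onSlice hGZ hKo hnf hHL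
    (missingLowerBoundAt_two_onSlice_of_shaLowerCAtTwo hGZ hGZK hnf hHL hMilneC hXL hZ) hZ

/-! ### §2 The iffs: named E-side half ⟺ one-sided K-side binder (odd-torsion form) -/

/-- **AN-28c-U ⟺ KOLYVAGIN'S UPPER BOUND AT `2` OVER `K` (odd-torsion form), BY NAME**, modulo PRINT (`gross_zagier`, `kolyvagin`, GZK,
`exists_isNewformOf`, Hoffstein–Luo, Milne 1972) and `S_rankZeroTwin`: the lead's `doorIndexLawUpperCAtTwo_iff_missingUpperBoundAt_onSlice`
followed by the width seat's `missingUpperBoundAt_onSlice_iff_shaUpperCAtTwo`.  Conditional by design; BSD is not proved by this.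
[cite: GrossLMS1991, Thm. 1.3, §2 Conj. (2.2) and §4] [cite: Milne1972ArithmeticAV, §1 Thm. 1] -/
theorem doorIndexLawUpperCAtTwo_iff_shaUpperCAtTwo
    (hGZ : ∀ (N : ℕ) [NeZero N] (W : WeierstrassCurve ℚ) (K : Type) [Field K] [NumberField K], gross_zagier N W K)
    (hKo : ∀ (N : ℕ) [NeZero N] (W : WeierstrassCurve ℚ) (K : Type) [Field K] [NumberField K], kolyvagin N W K)
    (hGZK : rank_eq_analyticRank_of_analyticRank_le_one) (hnf : exists_isNewformOf)
    (hHL : HoffsteinLuo1997_exists_twist_L_one_ne_zero) (hMilneC : Milne1972.bsdQuotient_baseChange_quadratic_anyModel)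
    (hZ : S_rankZeroTwin) :
    DoorIndexLawUpperCAtTwo ↔
      ∀ (W : WeierstrassCurve ℚ) [W.IsElliptic] [W.IsGloballyMinimal] [NeZero (W.conductorNorm ℤ)],
        ¬ W.HasCM → (∀ n : ℕ, W.HasSurjectiveModNGaloisRep ((2 ^ n : ℕ) : ℤ)) → Odd W.torsionOrder → Odd W.tamagawaProduct →
        W.analyticRank = 1 →
        ∀ (K : Type) [Field K] [NumberField K], IsImaginaryQuadratic K → Odd (NumberField.discr K) →
          NumberField.discr K ≠ -3 → SatisfiesHeegnerHypothesis (W.conductorNorm ℤ) K →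
          ¬ IsSquare ((NumberField.discr K : ℚ) * -|W.Δ|) → ¬ IsSquare ((NumberField.discr K : ℚ) * (-(2 * |W.Δ|))) →
          ∀ (Dt : ModularParametrizationData W (W.conductorNorm ℤ)) (β : ℤ) (ι : K →+* ℂ) (d₁ : KolyvaginHeegnerData Dt β ι 1),
            ¬ IsOfFinAddOrder d₁.derivedPoint → ∀ (M₀ : ℕ),
            (∃ Q : (W.baseChange (ringClassField K ι 1)).toAffine.Point, ((2 ^ M₀ : ℕ) : ℤ) • Q = d₁.derivedPoint) →
            (¬ ∃ Q : (W.baseChange (ringClassField K ι 1)).toAffine.Point, ((2 ^ (M₀ + 1) : ℕ) : ℤ) • Q = d₁.derivedPoint) →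
            (padicValNat 2 (Nat.card (AddCommGroup.primaryComponent (W.baseChange K).sha 2)) : ℤ) + 2 * padicValInt 2 Dt.c ≤ 2 * M₀ :=
  (doorIndexLawUpperCAtTwo_iff_missingUpperBoundAt_onSlice hGZ hKo hnf hHL hZ).trans
    (missingUpperBoundAt_onSlice_iff_shaUpperCAtTwo hGZ hGZK hnf hHL hMilneC hZ)

/-- **AN-28c-L ⟺ the reverse K-inequality (odd-torsion form), BY NAME**, modulo the same PRINT and `S_rankZeroTwin`.
Conditional by design. [cite: GrossLMS1991, §2 Conj. (2.2) and §4] [cite: Milne1972ArithmeticAV, §1 Thm. 1] -/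
theorem doorIndexLawLowerCAtTwo_iff_shaLowerCAtTwo
    (hGZ : ∀ (N : ℕ) [NeZero N] (W : WeierstrassCurve ℚ) (K : Type) [Field K] [NumberField K], gross_zagier N W K)
    (hKo : ∀ (N : ℕ) [NeZero N] (W : WeierstrassCurve ℚ) (K : Type) [Field K] [NumberField K], kolyvagin N W K)
    (hGZK : rank_eq_analyticRank_of_analyticRank_le_one) (hnf : exists_isNewformOf)
    (hHL : HoffsteinLuo1997_exists_twist_L_one_ne_zero) (hMilneC : Milne1972.bsdQuotient_baseChange_quadratic_anyModel)
    (hZ : S_rankZeroTwin) :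
    DoorIndexLawLowerCAtTwo ↔
      ∀ (W : WeierstrassCurve ℚ) [W.IsElliptic] [W.IsGloballyMinimal] [NeZero (W.conductorNorm ℤ)],
        ¬ W.HasCM → (∀ n : ℕ, W.HasSurjectiveModNGaloisRep ((2 ^ n : ℕ) : ℤ)) → Odd W.torsionOrder → Odd W.tamagawaProduct →
        W.analyticRank = 1 →
        ∀ (K : Type) [Field K] [NumberField K], IsImaginaryQuadratic K → Odd (NumberField.discr K) →
          NumberField.discr K ≠ -3 → SatisfiesHeegnerHypothesis (W.conductorNorm ℤ) K →
          ¬ IsSquare ((NumberField.discr K : ℚ) * -|W.Δ|) → ¬ IsSquare ((NumberField.discr K : ℚ) * (-(2 * |W.Δ|))) →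
          ∀ (Dt : ModularParametrizationData W (W.conductorNorm ℤ)) (β : ℤ) (ι : K →+* ℂ) (d₁ : KolyvaginHeegnerData Dt β ι 1),
            ¬ IsOfFinAddOrder d₁.derivedPoint → ∀ (M₀ : ℕ),
            (∃ Q : (W.baseChange (ringClassField K ι 1)).toAffine.Point, ((2 ^ M₀ : ℕ) : ℤ) • Q = d₁.derivedPoint) →
            (¬ ∃ Q : (W.baseChange (ringClassField K ι 1)).toAffine.Point, ((2 ^ (M₀ + 1) : ℕ) : ℤ) • Q = d₁.derivedPoint) →
            2 * (M₀ : ℤ) ≤ (padicValNat 2 (Nat.card (AddCommGroup.primaryComponent (W.baseChange K).sha 2)) : ℤ) + 2 * padicValInt 2 Dt.c :=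
  (doorIndexLawLowerCAtTwo_iff_missingLowerBoundAt_onSlice hGZ hKo hnf hHL hZ).trans
    (missingLowerBoundAt_onSlice_iff_shaLowerCAtTwo hGZ hGZK hnf hHL hMilneC hZ)

/-! ### §3 With the route's four rank-`0` cruxes BY NAME in place of `S_rankZeroTwin` -/

/-- **AN-28c-U BY NAME from Kolyvagin's upper bound at `2` over `K`, PRINT, and the route's four rank-`0` cruxes BY NAME**
(`rankZeroTwin_of_rankZero_cruxes`).  Conditional by design; BSD is not proved by this. [cite: GrossLMS1991, Thm. 1.3 and §4] -/
theorem doorIndexLawUpperCAtTwo_of_shaUpperCAtTwo_of_rankZero_cruxes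
    (hGZ : ∀ (N : ℕ) [NeZero N] (W : WeierstrassCurve ℚ) (K : Type) [Field K] [NumberField K], gross_zagier N W K)
    (hKo : ∀ (N : ℕ) [NeZero N] (W : WeierstrassCurve ℚ) (K : Type) [Field K] [NumberField K], kolyvagin N W K)
    (hGZK : rank_eq_analyticRank_of_analyticRank_le_one) (hnf : exists_isNewformOf)
    (hHL : HoffsteinLuo1997_exists_twist_L_one_ne_zero) (hMilneC : Milne1972.bsdQuotient_baseChange_quadratic_anyModel)
    (hXU : ∀ (W : WeierstrassCurve ℚ) [W.IsElliptic] [W.IsGloballyMinimal] [NeZero (W.conductorNorm ℤ)],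
      ¬ W.HasCM → (∀ n : ℕ, W.HasSurjectiveModNGaloisRep ((2 ^ n : ℕ) : ℤ)) → Odd W.tamagawaProduct → W.analyticRank = 1 →
      ∀ (K : Type) [Field K] [NumberField K], IsImaginaryQuadratic K → Odd (NumberField.discr K) →
        NumberField.discr K ≠ -3 → SatisfiesHeegnerHypothesis (W.conductorNorm ℤ) K →
        ¬ IsSquare ((NumberField.discr K : ℚ) * -|W.Δ|) → ¬ IsSquare ((NumberField.discr K : ℚ) * (-(2 * |W.Δ|))) →
        ∀ (Dt : ModularParametrizationData W (W.conductorNorm ℤ)) (β : ℤ) (ι : K →+* ℂ) (d₁ : KolyvaginHeegnerData Dt β ι 1),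
          ¬ IsOfFinAddOrder d₁.derivedPoint → ∀ (M₀ : ℕ),
          (∃ Q : (W.baseChange (ringClassField K ι 1)).toAffine.Point, ((2 ^ M₀ : ℕ) : ℤ) • Q = d₁.derivedPoint) →
          (¬ ∃ Q : (W.baseChange (ringClassField K ι 1)).toAffine.Point, ((2 ^ (M₀ + 1) : ℕ) : ℤ) • Q = d₁.derivedPoint) →
          (padicValNat 2 (Nat.card (AddCommGroup.primaryComponent (W.baseChange K).sha 2)) : ℤ) + 2 * padicValInt 2 Dt.c ≤ 2 * M₀)
    (hZ4 : GoodOrdinaryRankZeroAtTwo ∧ MultiplicativeRankZeroAtTwo ∧ SupersingularRankZeroAtTwo ∧ AdditiveRankZeroAtTwo) :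
    DoorIndexLawUpperCAtTwo :=
  doorIndexLawUpperCAtTwo_of_shaUpperCAtTwo hGZ hKo hGZK hnf hHL hMilneC hXU (rankZeroTwin_of_rankZero_cruxes hZ4)

/-- **AN-28c-L BY NAME from the reverse K-inequality, PRINT, and the route's four rank-`0` cruxes BY NAME.**  Conditional by design.
[cite: GrossLMS1991, §2 Conj. (2.2) and §4] -/
theorem doorIndexLawLowerCAtTwo_of_shaLowerCAtTwo_of_rankZero_cruxes
    (hGZ : ∀ (N : ℕ) [NeZero N] (W : WeierstrassCurve ℚ) (K : Type) [Field K] [NumberField K], gross_zagier N W K)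
    (hKo : ∀ (N : ℕ) [NeZero N] (W : WeierstrassCurve ℚ) (K : Type) [Field K] [NumberField K], kolyvagin N W K)
    (hGZK : rank_eq_analyticRank_of_analyticRank_le_one) (hnf : exists_isNewformOf)
    (hHL : HoffsteinLuo1997_exists_twist_L_one_ne_zero) (hMilneC : Milne1972.bsdQuotient_baseChange_quadratic_anyModel)
    (hXL : ∀ (W : WeierstrassCurve ℚ) [W.IsElliptic] [W.IsGloballyMinimal] [NeZero (W.conductorNorm ℤ)],
      ¬ W.HasCM → (∀ n : ℕ, W.HasSurjectiveModNGaloisRep ((2 ^ n : ℕ) : ℤ)) → Odd W.tamagawaProduct → W.analyticRank = 1 →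
      ∀ (K : Type) [Field K] [NumberField K], IsImaginaryQuadratic K → Odd (NumberField.discr K) →
        NumberField.discr K ≠ -3 → SatisfiesHeegnerHypothesis (W.conductorNorm ℤ) K →
        ¬ IsSquare ((NumberField.discr K : ℚ) * -|W.Δ|) → ¬ IsSquare ((NumberField.discr K : ℚ) * (-(2 * |W.Δ|))) →
        ∀ (Dt : ModularParametrizationData W (W.conductorNorm ℤ)) (β : ℤ) (ι : K →+* ℂ) (d₁ : KolyvaginHeegnerData Dt β ι 1),
          ¬ IsOfFinAddOrder d₁.derivedPoint → ∀ (M₀ : ℕ),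
          (∃ Q : (W.baseChange (ringClassField K ι 1)).toAffine.Point, ((2 ^ M₀ : ℕ) : ℤ) • Q = d₁.derivedPoint) →
          (¬ ∃ Q : (W.baseChange (ringClassField K ι 1)).toAffine.Point, ((2 ^ (M₀ + 1) : ℕ) : ℤ) • Q = d₁.derivedPoint) →
          2 * (M₀ : ℤ) ≤ (padicValNat 2 (Nat.card (AddCommGroup.primaryComponent (W.baseChange K).sha 2)) : ℤ) + 2 * padicValInt 2 Dt.c)
    (hZ4 : GoodOrdinaryRankZeroAtTwo ∧ MultiplicativeRankZeroAtTwo ∧ SupersingularRankZeroAtTwo ∧ AdditiveRankZeroAtTwo) :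
    DoorIndexLawLowerCAtTwo :=
  doorIndexLawLowerCAtTwo_of_shaLowerCAtTwo hGZ hKo hGZK hnf hHL hMilneC hXL (rankZeroTwin_of_rankZero_cruxes hZ4)

end Summit.BirchSwinnertonDyer.BirchSwinnertonDyer.Theorems.RankOneAtTwoOneDoor

end
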